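import Literature.Probability.RandomPlanarGeometry.HexSAWBrickWallStripFugacityWidthOneJointContactLDP
import Literature.Probability.RandomPlanarGeometry.HexSAWBrickWallStripRungRays
import HarnessLib

/-!
# The contraction from the contact-density pair to the total contact density, exactly: a Pythagorean identity of rates

Child module of `…JointContactLDP` (the joint rate `J(y,z;Y,Z)` of the contact-density pair `(bc/N, tc/N)` under `P_{N,y,z}`, its Legendre
form `isGreatest_jointRate`, `jointRate_pos`) and of `…RungRays` (the ray rate `I_ray(y,z;u) = rayRate y z u`, the LDP rate of the TOTAL
surface-contact fraction `(bc+tc)/N` — equivalently of the rung density — under every `P_{N,y,z}`, tilts along the ray `u ↦ (yu, zu)`).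
* §1 `rayRate_eq_jointRate` (`I_ray(y,z;u) = J(y,z; yu, zu)`: the ray rate is the joint rate of the ray point) and ★★★ the
  **CHANGE-OF-BASE IDENTITY** `J(y,z;Y,Z) = J(y',z';Y,Z) + [b(Y,Z) log(y'/y) + b(Z,Y) log(z'/z) − log(μ₁(y',z')/μ₁(y,z))]`;
* §2 ★★★ **PYTHAGORAS**: if `(Y,Z)` has the same total contact density as the ray point `(yu, zu)` then
  `J(y,z;Y,Z) = I_ray(y,z;u) + J(yu,zu;Y,Z)` — cost of the pair = cost of its total density + cost of the pair measured from the ray point;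
* §3 ★★★ **THE CONTRACTION PRINCIPLE, EXPLICITLY**: on the fibre `{(Y,Z) : b(Y,Z) + b(Z,Y) = b(yu,zu) + b(zu,yu)}` the joint rate is
  minimised EXACTLY at the ray point, with minimum `I_ray(y,z;u)` (`isLeast_jointRate_fibre`, strict off the ray point) — the rate of
  `(bc+tc)/N` is the infimum of the rate of `(bc/N, tc/N)` over the fibre, and the infimum is attained at the ray tilt.

## Sources
DemboZeitouni2010 §4.2.1 Theorem 4.2.1 (contraction principle) and §2.2 (Cramér; exponential change of measure); JansevanRensburg2000 §3.2
(1st ed., OUP 2000).  Nothing quoted AS PRINTED; the identities are this lineage's.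
-/

noncomputable section

open Filter Topology Finset Literature.Probability.LatticeModels Literature.Probability.Percolation SimpleGraph

namespace Literature.Probability.RandomPlanarGeometry.SAW.HexBW

open WidthOneYZ Real

variable {y z : ℝ}

/-! ## §1 The ray rate as a joint rate; change of base -/

/-- ★ `I_ray(y,z;u) = J(y,z; yu, zu)` for `y, z > 0` and every `u`: the ray rate of `…RungRays` is the joint rate of `…JointContactLDP` at the ray point.
[cite: DemboZeitouni2010, §2.2 (lane statement)] -/
theorem rayRate_eq_jointRate (hy : 0 < y) (hz : 0 < z) (u : ℝ) :
    rayRate y z u = jointRate y z (y * u) (z * u) := by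
  unfold rayRate jointRate
  rw [mul_div_cancel_left₀ _ hy.ne', mul_div_cancel_left₀ _ hz.ne']
  ring

/-- ★★★ **CHANGE OF BASE**: for `y, z, y', z', Y, Z > 0`,
`J(y,z;Y,Z) = J(y',z';Y,Z) + [b(Y,Z)·log(y'/y) + b(Z,Y)·log(z'/z) − log(μ₁(y',z')/μ₁(y,z))]` — the costs of the same tilt from two base
measures differ by an affine function of the densities. [cite: DemboZeitouni2010, §2.2 (exponential change of measure; lane statement)] -/
theorem jointRate_change_of_base (hy : 0 < y) (hz : 0 < z) {y' z' Y Z : ℝ} (hy' : 0 < y') (hz' : 0 < z') (hY : 0 < Y) (hZ : 0 < Z) :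
    jointRate y z Y Z = jointRate y' z' Y Z +
      (contactB Y Z * Real.log (y' / y) + contactB Z Y * Real.log (z' / z) - Real.log (stripMuY₂ 1 y' z' / stripMuY₂ 1 y z)) := by
  unfold jointRate
  rw [Real.log_div hY.ne' hy.ne', Real.log_div hZ.ne' hz.ne', Real.log_div hY.ne' hy'.ne', Real.log_div hZ.ne' hz'.ne',
    Real.log_div hy'.ne' hy.ne', Real.log_div hz'.ne' hz.ne',
    Real.log_div (stripMuY₂_pos 1 hY hZ).ne' (stripMuY₂_pos 1 hy hz).ne',
    Real.log_div (stripMuY₂_pos 1 hY hZ).ne' (stripMuY₂_pos 1 hy' hz').ne',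
    Real.log_div (stripMuY₂_pos 1 hy' hz').ne' (stripMuY₂_pos 1 hy hz).ne']
  ring

/-! ## §2 Pythagoras on a fibre of the total contact density -/

/-- ★★★ **PYTHAGOREAN IDENTITY**: for `y, z, u, Y, Z > 0` with `b(Y,Z) + b(Z,Y) = b(yu,zu) + b(zu,yu)` (the tilt `(Y,Z)` has the total contact
density of the ray point `u`), `J(y,z;Y,Z) = I_ray(y,z;u) + J(yu,zu;Y,Z)`.
[cite: DemboZeitouni2010, §4.2.1 Theorem 4.2.1 (contraction principle) and §2.2; JansevanRensburg2000, §3.2 (1st ed.; lane statement)] -/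
theorem jointRate_eq_rayRate_add (hy : 0 < y) (hz : 0 < z) {u Y Z : ℝ} (hu : 0 < u) (hY : 0 < Y) (hZ : 0 < Z)
    (hfib : contactB Y Z + contactB Z Y = contactB (y * u) (z * u) + contactB (z * u) (y * u)) :
    jointRate y z Y Z = rayRate y z u + jointRate (y * u) (z * u) Y Z := by
  have hyu : 0 < y * u := mul_pos hy hu
  have hzu : 0 < z * u := mul_pos hz hu
  rw [jointRate_change_of_base hy hz hyu hzu hY hZ]
  unfold rayRate
  rw [mul_div_cancel_left₀ _ hy.ne', mul_div_cancel_left₀ _ hz.ne', ← hfib]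
  ring

/-- ★★ **The joint rate dominates the ray rate on the fibre**: under the hypotheses of `jointRate_eq_rayRate_add`,
`I_ray(y,z;u) ≤ J(y,z;Y,Z)`, with equality iff `(Y,Z) = (yu, zu)`. [cite: DemboZeitouni2010, §4.2.1 Theorem 4.2.1 (lane statement)] -/
theorem rayRate_le_jointRate_of_fibre (hy : 0 < y) (hz : 0 < z) {u Y Z : ℝ} (hu : 0 < u) (hY : 0 < Y) (hZ : 0 < Z)
    (hfib : contactB Y Z + contactB Z Y = contactB (y * u) (z * u) + contactB (z * u) (y * u)) :
    rayRate y z u ≤ jointRate y z Y Z ∧ (rayRate y z u = jointRate y z Y Z ↔ (Y = y * u ∧ Z = z * u)) := by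
  have hyu : 0 < y * u := mul_pos hy hu
  have hzu : 0 < z * u := mul_pos hz hu
  rw [jointRate_eq_rayRate_add hy hz hu hY hZ hfib]
  have hnn := jointRate_nonneg_all hyu hzu hY hZ
  refine ⟨by linarith, ⟨fun h => ?_, fun h => ?_⟩⟩
  · by_contra hne
    have hne' : y * u ≠ Y ∨ z * u ≠ Z := by
      by_cases h1 : y * u = Y
      · right; intro h2; exact hne ⟨h1.symm, h2.symm⟩
      · left; exact h1
    have hpos := jointRate_pos hyu hzu hY hZ hne'
    linarith
  · obtain ⟨rfl, rfl⟩ := h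
    rw [jointRate_self hyu hzu, add_zero]

/-! ## §3 The contraction principle, explicitly -/

/-- ★★★ **THE RAY RATE IS THE FIBRE MINIMUM OF THE JOINT RATE**: for `y, z, u > 0`, `I_ray(y,z;u)` is the LEAST value of `J(y,z;Y,Z)` over
all tilts `(Y,Z) ∈ (0,∞)²` whose total contact density `b(Y,Z) + b(Z,Y)` equals that of the ray point `(yu,zu)`, attained at the ray point
(and only there, `rayRate_le_jointRate_of_fibre`).  Since `(Y,Z) ↦ (b(Y,Z), b(Z,Y))` is a bijection onto the open density triangle
(`contactB_eosY` / `eosY_contactB`), this is the contraction principle `rate of (bc+tc)/N = inf over the fibre of the rate of (bc/N, tc/N)`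
with an explicit minimiser. [cite: DemboZeitouni2010, §4.2.1 Theorem 4.2.1 (contraction principle); JansevanRensburg2000, §3.2 (1st ed.; lane statement)] -/
theorem isLeast_jointRate_fibre (hy : 0 < y) (hz : 0 < z) {u : ℝ} (hu : 0 < u) :
    IsLeast {r : ℝ | ∃ Y Z : ℝ, 0 < Y ∧ 0 < Z ∧
      contactB Y Z + contactB Z Y = contactB (y * u) (z * u) + contactB (z * u) (y * u) ∧ r = jointRate y z Y Z} (rayRate y z u) := by
  refine ⟨⟨y * u, z * u, mul_pos hy hu, mul_pos hz hu, rfl, rayRate_eq_jointRate hy hz u⟩, ?_⟩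
  rintro r ⟨Y, Z, hY, hZ, hfib, rfl⟩
  exact (rayRate_le_jointRate_of_fibre hy hz hu hY hZ hfib).1

/-- ★★★ **The same in density coordinates**: for `y, z, u > 0`, over the density pairs `(a,a')` of the open triangle with
`a + a' = b(yu,zu) + b(zu,yu)`, the rate `J̃_{y,z}(a,a') = J(y,z; Y(a,a'), Y(a',a))` is least at `(a,a') = (b(yu,zu), b(zu,yu))`, where it equals
`I_ray(y,z;u)`. [cite: DemboZeitouni2010, §4.2.1 Theorem 4.2.1 (lane statement)] -/
theorem isLeast_jointRate_eosY_fibre (hy : 0 < y) (hz : 0 < z) {u : ℝ} (hu : 0 < u) :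
    IsLeast {r : ℝ | ∃ a a' : ℝ, a + a' < 1 / 2 ∧ 1 < 4 * a + 2 * a' ∧ 1 < 2 * a + 4 * a' ∧
      a + a' = contactB (y * u) (z * u) + contactB (z * u) (y * u) ∧ r = jointRate y z (eosY a a') (eosY a' a)} (rayRate y z u) := by
  have hyu : 0 < y * u := mul_pos hy hu
  have hzu : 0 < z * u := mul_pos hz hu
  obtain ⟨t1, t2, t3⟩ := contactB_mem_triangle hyu hzu
  obtain ⟨eY, eZ⟩ := eosY_contactB hyu hzu
  refine ⟨⟨contactB (y * u) (z * u), contactB (z * u) (y * u), t1, t2, t3, rfl, ?_⟩, ?_⟩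
  · rw [eY, eZ]; exact rayRate_eq_jointRate hy hz u
  · rintro r ⟨a, a', h1, h2, h3, hfib, rfl⟩
    obtain ⟨hY0, hZ0, hb, hb', -, -⟩ := contactB_eosY h1 h2 h3
    have hfib' : contactB (eosY a a') (eosY a' a) + contactB (eosY a' a) (eosY a a') =
        contactB (y * u) (z * u) + contactB (z * u) (y * u) := by rw [hb, hb']; exact hfib
    exact (rayRate_le_jointRate_of_fibre hy hz hu hY0 hZ0 hfib').1

/-- ★★ **Uniqueness of the fibre minimiser in density coordinates**: equality `J̃_{y,z}(a,a') = I_ray(y,z;u)` on the fibre holds iff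
`(a,a') = (b(yu,zu), b(zu,yu))`. [cite: DemboZeitouni2010, §4.2.1 Theorem 4.2.1 (lane statement)] -/
theorem jointRate_eosY_eq_rayRate_iff (hy : 0 < y) (hz : 0 < z) {u a a' : ℝ} (hu : 0 < u) (h1 : a + a' < 1 / 2)
    (h2 : 1 < 4 * a + 2 * a') (h3 : 1 < 2 * a + 4 * a') (hfib : a + a' = contactB (y * u) (z * u) + contactB (z * u) (y * u)) :
    jointRate y z (eosY a a') (eosY a' a) = rayRate y z u ↔ (a = contactB (y * u) (z * u) ∧ a' = contactB (z * u) (y * u)) := by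
  have hyu : 0 < y * u := mul_pos hy hu
  have hzu : 0 < z * u := mul_pos hz hu
  obtain ⟨hY0, hZ0, hb, hb', -, -⟩ := contactB_eosY h1 h2 h3
  have hfib' : contactB (eosY a a') (eosY a' a) + contactB (eosY a' a) (eosY a a') =
      contactB (y * u) (z * u) + contactB (z * u) (y * u) := by rw [hb, hb']; exact hfib
  have key := (rayRate_le_jointRate_of_fibre hy hz hu hY0 hZ0 hfib').2
  constructor
  · intro h
    obtain ⟨e1, e2⟩ := key.1 h.symm
    refine ⟨?_, ?_⟩
    · rw [← hb, e1, e2]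
    · rw [← hb', e1, e2]
  · rintro ⟨e1, e2⟩
    obtain ⟨eY, eZ⟩ := eosY_contactB hyu hzu
    rw [e1, e2, eY, eZ, ← rayRate_eq_jointRate hy hz u]

end Literature.Probability.RandomPlanarGeometry.SAW.HexBW
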